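import Summits.Ventures.HSemireg.WedgeHankelRecurrenceSymbol
import Mathlib.LinearAlgebra.Lagrange

/-!
# Venture HSemireg — PARTIAL FRACTIONS: **every finite sum of geometric sequences is a rational class — `(Σ_{i∈s} A_i λ_i^j)_j = dualSeq (nodal s λ) (Σ_{i∈s} A_i · nodal (s ∖ i) λ)`**, the moment sequence of
# `Σ_i A_i/(X − λ_i) = (Σ_i A_i ∏_{j≠i} (X − λ_j)) / ∏_i (X − λ_i)`, for ANY finitely many nodes (repetitions allowed) and weights; with unit weights the numerator is the derivative (N80's power sums)

HONEST FRAMING. Part of the Lean index of the computation cell `pub-hsemireg` (seat p10 gen 30, Sunday typer «UNIFORM-IN-n»).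
LINEAR ALGEBRA OF HANKEL (catalecticant) MATRICES and of polynomials over a field ONLY (`Polynomial.modByMonic`, `Lagrange.nodal`): no variety, no cohomology theory, no sheaf, no Ext group and
no semiregularity map is constructed here; nothing here says that HC / HC_CM / HC_AV holds; no Literature fact is declared or used.  Custodian versions as in `WedgeHankelSiegelIdeal` (1/3); the
dictionary («partial fraction expansion of a proper rational function with split denominator», Lagrange) is QUOTED in docstrings, never asserted.

WHAT IS IN THE TREE.  N45 (`WedgeHankelRecurrenceSymbol`, № 327): `dualSeq_add_dualSeq` (addition of symbols); N32 (№ 263): `dualSeq_apply`, `dualSeq_smul`; `WedgeHankelSecantRank` (tree): `secSeq`.  Mathlib: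
`Lagrange.nodal` (`nodal s v = ∏_{i∈s} (X − C (v i))`), `Lagrange.nodal_insert_eq_nodal`, `Lagrange.nodal_monic`, `Lagrange.nodal_empty`, `Lagrange.derivative_nodal`, `Finset.erase_insert`,
`Finset.erase_insert_of_ne`, `Finset.sum_insert`, `Polynomial.modByMonic_X_sub_C_eq_C_eval`.
THIS FILE (namespace `Summit.Ventures.HSemireg.Wedge.HankelOuter` continued; PLAIN on N45 (+ `Mathlib.LinearAlgebra.Lagrange`); 0 definitions):
* §641 `dualSeq_X_sub_C_C` (`dualSeq (X − c) (C a) = (a·c^j)_j`), `dualSeq_one_eq_zero` (`dualSeq 1 a = 0`), **`sum_mul_pow_eq_dualSeq_nodal`** (THE PARTIAL FRACTION DICTIONARY for a `Finset` of indices, any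
  nodes and weights), **`secSeq_eq_dualSeq_nodal`** (`secSeq A λ = dualSeq (nodal univ λ) (Σ_i C (A i) · nodal (univ ∖ i) λ)`), `sum_pow_eq_dualSeq_nodal_derivative` (unit weights: the numerator is
  `(nodal s λ)′`, Mathlib `Lagrange.derivative_nodal` — N80's power sums, now indexed by a `Finset`).
Nothing Ext-side.  New names only.
-/

open Module Polynomial
open scoped Matrix Polynomial

namespace Summit.Ventures.HSemireg.Wedge.HankelOuter

open Summit.Ventures.HSemireg.Wedge Summit.Ventures.HSemireg.Wedge.Hankel Summit.Ventures.HSemireg.Wedge.HankelSecant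

variable (K : Type*) [Field K]

/-! ## §641. Partial fractions -/

/-- **`dualSeq (X − c) (C a) = (a·c^j)_j`**: the moment sequence of `a/(X − c)` is the geometric class of ratio `c` and weight `a`. -/
theorem dualSeq_X_sub_C_C (c a : K) : dualSeq K (Polynomial.X - C c) (C a) = fun j => a * c ^ j := by
  funext j
  rw [dualSeq_apply, Polynomial.modByMonic_X_sub_C_eq_C_eval, Polynomial.natDegree_X_sub_C, Nat.sub_self, Polynomial.coeff_C_zero, Polynomial.eval_mul, Polynomial.eval_pow,
    Polynomial.eval_X, Polynomial.eval_C, mul_comm]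

/-- `dualSeq 1 a = 0` (the empty denominator). -/
theorem dualSeq_one_eq_zero (a : K[X]) : dualSeq K (1 : K[X]) a = 0 := by
  funext j
  rw [dualSeq_apply, Polynomial.modByMonic_one, Polynomial.coeff_zero, Pi.zero_apply]

/-- **PARTIAL FRACTIONS: `(Σ_{i∈s} A_i λ_i^j)_j = dualSeq (nodal s λ) (Σ_{i∈s} C (A_i) · nodal (s.erase i) λ)`** for every finite set `s` of indices, any nodes `λ` (repetitions allowed) and weights `A`
— the moment sequence of `Σ_{i∈s} A_i/(X − λ_i)` (induction on `s`: `nodal (insert i s) = (X − λ_i)·nodal s` and N45's addition of symbols). -/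
theorem sum_mul_pow_eq_dualSeq_nodal {ι : Type*} [DecidableEq ι] (s : Finset ι) (lam A : ι → K) :
    (fun j => ∑ i ∈ s, A i * lam i ^ j) = dualSeq K (Lagrange.nodal s lam) (∑ i ∈ s, C (A i) * Lagrange.nodal (s.erase i) lam) := by
  induction s using Finset.induction_on with
  | empty =>
    funext j
    rw [Finset.sum_empty, Finset.sum_empty, Lagrange.nodal_empty, dualSeq_one_eq_zero, Pi.zero_apply]
  | insert i s hi ih =>
    have hnum : (∑ k ∈ insert i s, C (A k) * Lagrange.nodal ((insert i s).erase k) lam)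
        = C (A i) * Lagrange.nodal s lam + (∑ k ∈ s, C (A k) * Lagrange.nodal (s.erase k) lam) * (Polynomial.X - C (lam i)) := by
      rw [Finset.sum_insert hi, Finset.erase_insert hi, Finset.sum_mul]
      congr 1
      refine Finset.sum_congr rfl fun k hk => ?_
      have hki : k ≠ i := fun h => hi (h ▸ hk)
      rw [Finset.erase_insert_of_ne hki.symm, Lagrange.nodal_insert_eq_nodal (fun h => hi (Finset.mem_erase.mp h).2)]
      ring
    rw [hnum, Lagrange.nodal_insert_eq_nodal hi, mul_comm (Polynomial.X - C (lam i)), add_comm (C (A i) * Lagrange.nodal s lam),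
      ← dualSeq_add_dualSeq K (Lagrange.nodal_monic (s := s) (v := lam)) (Polynomial.monic_X_sub_C (lam i)), ← ih, dualSeq_X_sub_C_C]
    funext j
    simp only [Pi.add_apply, Finset.sum_insert hi]
    ring

/-- **THE SECANT CLASS AS A RATIONAL CLASS: `secSeq A λ = dualSeq (∏_i (X − λ_i)) (Σ_i C (A_i) · ∏_{j≠i} (X − λ_j))`** (`λ : Fin r → K` any, `A` any). -/
theorem secSeq_eq_dualSeq_nodal {r : ℕ} (A lam : Fin r → K) :
    secSeq K A lam = dualSeq K (Lagrange.nodal Finset.univ lam) (∑ i, C (A i) * Lagrange.nodal (Finset.univ.erase i) lam) := by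
  have h := sum_mul_pow_eq_dualSeq_nodal K (Finset.univ : Finset (Fin r)) lam A
  rw [← h]
  rfl

/-- **UNIT WEIGHTS: `(Σ_{i∈s} λ_i^j)_j = dualSeq (nodal s λ) (nodal s λ)′`** — the power sums over `s` are the moment sequence of `nodal′/nodal` (Mathlib `Lagrange.derivative_nodal`). -/
theorem sum_pow_eq_dualSeq_nodal_derivative {ι : Type*} [DecidableEq ι] (s : Finset ι) (lam : ι → K) :
    (fun j => ∑ i ∈ s, lam i ^ j) = dualSeq K (Lagrange.nodal s lam) (derivative (Lagrange.nodal s lam)) := by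
  have h := sum_mul_pow_eq_dualSeq_nodal K s lam (fun _ => (1 : K))
  simp only [one_mul, map_one] at h
  rw [h, Lagrange.derivative_nodal]

end Summit.Ventures.HSemireg.Wedge.HankelOuter
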